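import Summits.PneNP.PneNP.Theorems.SzkEntropyPeaThreeNotInPCoreDefs
import Mathlib.LinearAlgebra.Matrix.Rank
import Mathlib.LinearAlgebra.Matrix.NonsingularInverse
import Mathlib.LinearAlgebra.Matrix.Kronecker
import Mathlib.Logic.Equiv.Fin.Basic
import Mathlib.Algebra.Field.ZMod

/-!
# Route SzkEntropy, crux `PeaThreeNotInP` (stmt-PneNP-10776), line `SketchIdeator3`, step S7: the
# fixed concise non-isomorphic pair (registered stub `stub_fixedPair`)

The unit tensor `tU = e₀⊗e₀⊗e₀ + e₁⊗e₁⊗e₁` and the W-tensor `tW = e₀⊗e₀⊗e₁ + e₀⊗e₁⊗e₀ + e₁⊗e₀⊗e₀`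
of format `2 × 2 × 2` over `F₂` are both concise and are NOT isomorphic under `GL₂(F₂)³`.

* Conciseness: both tensors are symmetric under permuting the three directions, so all three
  flattenings are the same `2 × 4` matrix; it has a right inverse, hence rank `2`.
* Non-isomorphism by an isomorphism invariant: the number of pairs of vectors `(v, w)` annihilated
  by the tensor, `T(·, v, w) = 0`, i.e. `T *ᵥ (v ⊗ w) = 0`.  For any matrix triple `(A, B, C)`,
  `((A,B,C)·T) *ᵥ (v ⊗ w) = A *ᵥ (T *ᵥ (Bᵀv ⊗ Cᵀw))`; for invertible `A, B, C` the map
  `(v, w) ↦ (Bᵀ v, Cᵀ w)` is a bijection and `A *ᵥ ·` has trivial kernel, so the count is invariant.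
  It is `9` for `tU` (`v₀w₀ = v₁w₁ = 0`) and `8` for `tW` (`v₀w₀ = 0`, `v₀w₁ = v₁w₀`).

Sources: J. A. Grochow, Y. Qiao, *On the complexity of isomorphism problems for tensors, groups, and
polynomials I*, SIAM J. Comput. 52 (2023), §2 (the action, flattenings, nondegenerate tensors);
folklore (unit tensor vs. W-tensor).
-/

noncomputable section

open Matrix
open scoped Kronecker
open _root_.Computability
open Literature.Computability.Complexity

namespace Summit.PneNP.PneNP.Cruxes.PeaThreeNotInP.TensorIsoLine

set_option linter.dupNamespace false -- `Summit.PneNP.PneNP.…`: summit = sub-problem name (D-0017 single-conjunct layout)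

/-! ### Entries and flattenings of the two tensors -/

/-- Entries of the unit tensor: `tU i (j,k) = 1` iff `i = j = k`. [folklore] -/
theorem fixed_tU_apply (i j k : Fin 2) : tU i (j, k) = if i = j ∧ j = k then 1 else 0 := by
  fin_cases i <;> fin_cases j <;> fin_cases k <;> rfl

/-- Entries of the W-tensor: `tW i (j,k) = 1` iff exactly one of `i, j, k` is `1`. [folklore] -/
theorem fixed_tW_apply (i j k : Fin 2) :
    tW i (j, k) = if i.val + j.val + k.val = 1 then 1 else 0 := by
  fin_cases i <;> fin_cases j <;> fin_cases k <;> rfl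

/-- The unit tensor is symmetric: its second flattening is the same matrix. [folklore] -/
theorem fixed_flat₂_tU : flat₂ tU = tU := by
  ext i ⟨j, k⟩
  fin_cases i <;> fin_cases j <;> fin_cases k <;> rfl

/-- The unit tensor is symmetric: its third flattening is the same matrix. [folklore] -/
theorem fixed_flat₃_tU : flat₃ tU = tU := by
  ext i ⟨j, k⟩
  fin_cases i <;> fin_cases j <;> fin_cases k <;> rfl

/-- The W-tensor is symmetric: its second flattening is the same matrix. [folklore] -/
theorem fixed_flat₂_tW : flat₂ tW = tW := by
  ext i ⟨j, k⟩
  fin_cases i <;> fin_cases j <;> fin_cases k <;> rfl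

/-- The W-tensor is symmetric: its third flattening is the same matrix. [folklore] -/
theorem fixed_flat₃_tW : flat₃ tW = tW := by
  ext i ⟨j, k⟩
  fin_cases i <;> fin_cases j <;> fin_cases k <;> rfl

/-! ### Conciseness: the flattenings have right inverses -/

/-- A `2 × 4` matrix over `F₂` with a right inverse has rank `2`. [folklore] -/
theorem fixed_rank_eq_two_of_mul_eq_one (T : Tensor3 2 2 2)
    (R : Matrix (Fin 2 × Fin 2) (Fin 2) (ZMod 2)) (h : T * R = 1) : T.rank = 2 := by
  refine le_antisymm ?_ ?_
  · simpa using Matrix.rank_le_card_height T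
  · calc 2 = (1 : Matrix (Fin 2) (Fin 2) (ZMod 2)).rank := by
          rw [Matrix.rank_one, Fintype.card_fin]
      _ = (T * R).rank := by rw [h]
      _ ≤ T.rank := Matrix.rank_mul_le_left _ _

/-- The first flattening of the unit tensor times its transpose is the identity. [folklore] -/
theorem fixed_tU_mul_transpose : tU * tUᵀ = 1 := by
  decide

/-- A right inverse of the first flattening of the W-tensor. [folklore] -/
theorem fixed_tW_mul : tW * (ofSupportN 2 2 2 [(0, 0, 1), (1, 0, 0)])ᵀ = 1 := by
  decide

/-- The first flattening of the unit tensor has rank `2`. [folklore] -/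
theorem fixed_rank_tU : tU.rank = 2 :=
  fixed_rank_eq_two_of_mul_eq_one tU _ fixed_tU_mul_transpose

/-- The first flattening of the W-tensor has rank `2`. [folklore] -/
theorem fixed_rank_tW : tW.rank = 2 :=
  fixed_rank_eq_two_of_mul_eq_one tW _ fixed_tW_mul

/-- The unit tensor is concise. [GrochowQiao2023, §2] -/
theorem fixed_concise_tU : Concise tU :=
  ⟨fixed_rank_tU, by rw [fixed_flat₂_tU]; exact fixed_rank_tU,
    by rw [fixed_flat₃_tU]; exact fixed_rank_tU⟩

/-- The W-tensor is concise. [GrochowQiao2023, §2] -/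
theorem fixed_concise_tW : Concise tW :=
  ⟨fixed_rank_tW, by rw [fixed_flat₂_tW]; exact fixed_rank_tW,
    by rw [fixed_flat₃_tW]; exact fixed_rank_tW⟩

/-! ### The invariant: pairs of vectors annihilated by the tensor -/

variable {a b c : ℕ}

/-- A Kronecker product acts on a product vector factorwise:
`(P ⊗ Q) *ᵥ (v ⊗ w) = (P *ᵥ v) ⊗ (Q *ᵥ w)`. [folklore] -/
theorem fixed_kronecker_mulVec_prod (P : Matrix (Fin b) (Fin b) (ZMod 2))
    (Q : Matrix (Fin c) (Fin c) (ZMod 2)) (v : Fin b → ZMod 2) (w : Fin c → ZMod 2) :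
    (P ⊗ₖ Q) *ᵥ (fun p : Fin b × Fin c => v p.1 * w p.2) =
      fun p : Fin b × Fin c => (P *ᵥ v) p.1 * (Q *ᵥ w) p.2 := by
  funext ⟨j, k⟩
  simp only [Matrix.mulVec, dotProduct, Fintype.sum_prod_type, Matrix.kroneckerMap_apply,
    Finset.sum_mul_sum]
  refine Finset.sum_congr rfl fun j' _ => Finset.sum_congr rfl fun k' _ => ?_
  ring

/-- The transformation law of the invariant: `((A,B,C)·T) *ᵥ (v ⊗ w) = A *ᵥ (T *ᵥ (Bᵀv ⊗ Cᵀw))`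
for ANY matrix triple. [GrochowQiao2023, §2] -/
theorem fixed_tensorAct_mulVec_prod (g : Triple a b c) (T : Tensor3 a b c) (v : Fin b → ZMod 2)
    (w : Fin c → ZMod 2) :
    tensorAct g T *ᵥ (fun p : Fin b × Fin c => v p.1 * w p.2) =
      g.1 *ᵥ (T *ᵥ fun p : Fin b × Fin c => (g.2.1ᵀ *ᵥ v) p.1 * (g.2.2ᵀ *ᵥ w) p.2) := by
  obtain ⟨A, B, C⟩ := g
  simp only [tensorAct]
  rw [← Matrix.mulVec_mulVec, ← Matrix.mulVec_mulVec, ← Matrix.kroneckerMap_transpose,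
    fixed_kronecker_mulVec_prod]

/-- **Invariance.** For an invertible triple `g`, the number of pairs `(v, w)` annihilated by `g·T`
equals the number annihilated by `T` (re-index by the bijection `(v, w) ↦ (Bᵀ v, Cᵀ w)`; `A *ᵥ ·`
has trivial kernel). [folklore] -/
theorem fixed_card_annih_tensorAct (g : Triple a b c) (hA : IsUnit g.1) (hB : IsUnit g.2.1)
    (hC : IsUnit g.2.2) (T : Tensor3 a b c) :
    Nat.card {vw : (Fin b → ZMod 2) × (Fin c → ZMod 2) //
        tensorAct g T *ᵥ (fun p : Fin b × Fin c => vw.1 p.1 * vw.2 p.2) = 0} =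
      Nat.card {vw : (Fin b → ZMod 2) × (Fin c → ZMod 2) //
        T *ᵥ (fun p : Fin b × Fin c => vw.1 p.1 * vw.2 p.2) = 0} := by
  have hinjA : Function.Injective g.1.mulVec := Matrix.mulVec_injective_of_isUnit hA
  have hbijB : Function.Bijective g.2.1ᵀ.mulVec :=
    ⟨Matrix.mulVec_injective_of_isUnit ((Matrix.isUnit_transpose _).2 hB),
      Matrix.mulVec_surjective_iff_isUnit.2 ((Matrix.isUnit_transpose _).2 hB)⟩
  have hbijC : Function.Bijective g.2.2ᵀ.mulVec :=
    ⟨Matrix.mulVec_injective_of_isUnit ((Matrix.isUnit_transpose _).2 hC),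
      Matrix.mulVec_surjective_iff_isUnit.2 ((Matrix.isUnit_transpose _).2 hC)⟩
  refine Nat.card_congr (Equiv.subtypeEquiv
    (Equiv.prodCongr (Equiv.ofBijective _ hbijB) (Equiv.ofBijective _ hbijC)) ?_)
  rintro ⟨v, w⟩
  simp only [Equiv.prodCongr_apply, Prod.map, Equiv.ofBijective_apply]
  rw [fixed_tensorAct_mulVec_prod]
  constructor
  · intro h
    exact hinjA (h.trans (Matrix.mulVec_zero _).symm)
  · intro h
    rw [h, Matrix.mulVec_zero]

/-! ### The two counts -/

/-- The unit tensor annihilates `(v, w)` iff `v₀w₀ = 0` and `v₁w₁ = 0`. [folklore] -/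
theorem fixed_tU_mulVec_eq_zero (x : Fin 2 × Fin 2 → ZMod 2) :
    tU *ᵥ x = 0 ↔ x (0, 0) = 0 ∧ x (1, 1) = 0 := by
  simp [funext_iff, Fin.forall_fin_two, Matrix.mulVec, dotProduct, Fintype.sum_prod_type,
    Fin.sum_univ_two, fixed_tU_apply]

/-- The W-tensor annihilates `(v, w)` iff `x₀₁ + x₁₀ = 0` and `x₀₀ = 0`. [folklore] -/
theorem fixed_tW_mulVec_eq_zero (x : Fin 2 × Fin 2 → ZMod 2) :
    tW *ᵥ x = 0 ↔ x (0, 1) + x (1, 0) = 0 ∧ x (0, 0) = 0 := by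
  simp [funext_iff, Fin.forall_fin_two, Matrix.mulVec, dotProduct, Fintype.sum_prod_type,
    Fin.sum_univ_two, fixed_tW_apply]

/-- The unit tensor annihilates exactly `9` of the `16` pairs of vectors. [folklore] -/
theorem fixed_card_annih_tU :
    Nat.card {vw : (Fin 2 → ZMod 2) × (Fin 2 → ZMod 2) //
        tU *ᵥ (fun p : Fin 2 × Fin 2 => vw.1 p.1 * vw.2 p.2) = 0} = 9 := by
  rw [Nat.card_congr (Equiv.subtypeEquiv
    (q := fun x : (ZMod 2 × ZMod 2) × (ZMod 2 × ZMod 2) => x.1.1 * x.2.1 = 0 ∧ x.1.2 * x.2.2 = 0)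
    (Equiv.prodCongr (finTwoArrowEquiv _) (finTwoArrowEquiv _)) ?_)]
  · rw [Nat.card_eq_fintype_card]
    rfl
  · rintro ⟨v, w⟩
    simp [fixed_tU_mulVec_eq_zero]

/-- The W-tensor annihilates exactly `8` of the `16` pairs of vectors. [folklore] -/
theorem fixed_card_annih_tW :
    Nat.card {vw : (Fin 2 → ZMod 2) × (Fin 2 → ZMod 2) //
        tW *ᵥ (fun p : Fin 2 × Fin 2 => vw.1 p.1 * vw.2 p.2) = 0} = 8 := by
  rw [Nat.card_congr (Equiv.subtypeEquiv
    (q := fun x : (ZMod 2 × ZMod 2) × (ZMod 2 × ZMod 2) =>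
      x.1.1 * x.2.2 + x.1.2 * x.2.1 = 0 ∧ x.1.1 * x.2.1 = 0)
    (Equiv.prodCongr (finTwoArrowEquiv _) (finTwoArrowEquiv _)) ?_)]
  · rw [Nat.card_eq_fintype_card]
    rfl
  · rintro ⟨v, w⟩
    simp [fixed_tW_mulVec_eq_zero]

/-! ### The registered stub -/

/-- **stub (W4)**: the fixed pair — the unit tensor and the W-tensor of format `2 × 2 × 2` are
concise and not isomorphic (the number of pairs of vectors `(v, w)` annihilated by the tensor is an
isomorphism invariant; it is `9` for the unit tensor and `8` for the W-tensor). [folklore] -/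
theorem stub_fixedPair : Concise tU ∧ Concise tW ∧ ¬ Iso tU tW := by
  refine ⟨fixed_concise_tU, fixed_concise_tW, ?_⟩
  rintro ⟨g, hA, hB, hC, hUW⟩
  have h := fixed_card_annih_tensorAct g hA hB hC tW
  rw [← hUW, fixed_card_annih_tU, fixed_card_annih_tW] at h
  omega

end Summit.PneNP.PneNP.Cruxes.PeaThreeNotInP.TensorIsoLine

end
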